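import Summits.Ventures.LatticeQCDFlow.Scaling.TaggedHubCertificate

/-!
HONEST FRAMING: exact (Metropolis-corrected) sampling algorithms for lattice gauge theory; figures
of merit are autocorrelation/cost numbers at stated couplings and volumes; no continuum-physics
claim.

# StartStateDomination — RAYLEIGH MONOTONICITY FOR THE DIAGONAL OF THE RESOLVENT: IF TWO REVERSIBLE KERNELS HAVE `m ≤ m'` AND CONDUCTANCES `c ≤ c'`, THEN AT ANY STATE `z` WITH
# `m(z) = m'(z)` THE DISCOUNTED RETURN MASS IS LARGER FOR THE SMALLER NETWORK, `G'_σ(z,z) ≤ G_σ(z,z)`; HENCE CONJECTURE D OF MEMO-gen37 HOLDS AT THE START CONTENT: THE COPY WITH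
# THE MORE PERSISTENT EXTRA PARTICLE HAS THE LARGER TAIL MASS AT THE HUB'S OWN CONTENT, `ỹ(z) ≤ x̃(z)`, AT EVERY SWAP ODDS (lean-2 GEN-37, ours)

Venture-side (OURS).  Cell `lqcd-flow` (pub-lqcd), unit `pub-lqcd-lean-2-g37`, 2026-08-29.  Chapter W (item 1 (i) at finite swap odds), file 20.  MEMO-gen37 §5b: domination (D) fails per
step only AT the start state, where the discounted form is a DIRICHLET PRINCIPLE: for a kernel `P` reversible w.r.t. `m > 0` (`m(h)P(h,k) = m(k)P(k,h)`), the quadratic form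
`Q(g) = Σ_h m(h)g(h)((I−σP)g)(h) = (1−σ)Σ_h m(h)g(h)² + (σ/2)Σ_{h,k} m(h)P(h,k)(g(h)−g(k))²` is non-negative and the column resolvent `f = δ_z + σPf` satisfies
`m(z)f(z) = 2m(z)g(z) − Q(g) + Q(g − f) ≥ 2m(z)g(z) − Q(g)` for every `g` (equality at `g = f`).  If a second reversible kernel `P'` (w.r.t. `m'`) has `m' ≥ m`, conductances
`m'(h)P'(h,k) ≥ m(h)P(h,k)` (`h ≠ k`) and `m'(z) = m(z)`, then `Q ≤ Q'` pointwise, so `m(z)f(z) ≥ 2m(z)f'(z) − Q(f') ≥ 2m(z)f'(z) − Q'(f') = m(z)f'(z)`: **`f'(z) ≤ f(z)`**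
(`resolventDiag_mono`).  For the two tagged hub chains of files 14–16 (`X` tags `a`, `Y` tags `b`, `W_a ≥ W_b`, same ordinary composition `N_C`): `m = N_C/W` on ordinary contents for both,
`m(★) = 1/W_a ≤ 1/W_b = m'(★)`, all ordinary conductances agree and `N_C(h)min{1/W_h,1/W_a}/K ≤ N_C(h)min{1/W_h,1/W_b}/K` into ★ (`tagged_conductance_le`); the row tail laws `x̃`, `ỹ`
from the ordinary start `z` relate to the column resolvents by reversibility, whence **`ỹ(z) ≤ x̃(z)`** (`tagged_start_domination`) — the `w = z` instance of hypothesis (D) of file 16,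
now proved.  Hypothesis-equations, no definitions.

## What is proved

* §1 `dirichlet_form_eq` (the Dirichlet-form identity), `dirichlet_form_nonneg`, `dirichlet_bilinear_symm`, **`resolventDiag_variational`**, **`resolventDiag_mono`**, `rowResolvent_to_column`.
* §2 `tagged_detailedBalance`, `tagged_mass_nonneg`, `tagged_mass_eq_zero`, `tagged_null_row`, **`tagged_start_domination`** (§1 also has `rowResolvent_to_column`).

Reading (no numerics implied): Rayleigh's monotonicity law in resolvent form.  NOT CLAIMED: domination at contents other than the start (Conjecture M′ of MEMO-gen37, per step in the toy).
Literature grade (cell rule): OWN, elementary (the Dirichlet principle is classical: Doyle–Snell; no statement is cited as a fact); no new bib keys.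
-/

open Finset

namespace Summit.Ventures.LatticeQCDFlow.Scaling

/-! ## §1 The Dirichlet principle for the diagonal of the resolvent -/

section Dirichlet
variable {T : Type*} [Fintype T] [DecidableEq T]
variable {P : T → T → ℝ} {m : T → ℝ} {σ : ℝ}

omit [DecidableEq T] in
/-- **The Dirichlet-form identity:** for `P` reversible w.r.t. `m` with unit row sums,
`Σ_h m(h)g(h)(g(h) − σΣ_k P(h,k)g(k)) = (1−σ)Σ_h m(h)g(h)² + (σ/2)Σ_hΣ_k m(h)P(h,k)(g(h) − g(k))²`. [ours] -/
theorem dirichlet_form_eq (hrev : ∀ h k, m h * P h k = m k * P k h) (hP1 : ∀ h, ∑ k, P h k = 1) (g : T → ℝ) :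
    ∑ h, m h * g h * (g h - σ * ∑ k, P h k * g k)
      = (1 - σ) * ∑ h, m h * g h ^ 2 + σ / 2 * ∑ h, ∑ k, m h * P h k * (g h - g k) ^ 2 := by
  -- expand the square and use reversibility on the `g(k)²` part
  have hsq : ∑ h, ∑ k, m h * P h k * (g h - g k) ^ 2
      = ∑ h, m h * g h ^ 2 + ∑ h, m h * g h ^ 2 - 2 * ∑ h, ∑ k, m h * P h k * (g h * g k) := by
    have e1 : ∑ h, ∑ k, m h * P h k * g h ^ 2 = ∑ h, m h * g h ^ 2 := by
      refine sum_congr rfl fun h _ => ?_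
      rw [← sum_mul, ← mul_sum, hP1, mul_one]
    have e2 : ∑ h, ∑ k, m h * P h k * g k ^ 2 = ∑ h, m h * g h ^ 2 := by
      rw [sum_comm]
      refine sum_congr rfl fun k _ => ?_
      calc ∑ h, m h * P h k * g k ^ 2 = ∑ h, m k * P k h * g k ^ 2 := sum_congr rfl fun h _ => by rw [hrev h k]
        _ = m k * g k ^ 2 := by rw [← sum_mul, ← mul_sum, hP1, mul_one]
    calc ∑ h, ∑ k, m h * P h k * (g h - g k) ^ 2
        = ∑ h, ∑ k, (m h * P h k * g h ^ 2 + m h * P h k * g k ^ 2 - 2 * (m h * P h k * (g h * g k))) :=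
          sum_congr rfl fun h _ => sum_congr rfl fun k _ => by ring
      _ = ∑ h, ∑ k, m h * P h k * g h ^ 2 + ∑ h, ∑ k, m h * P h k * g k ^ 2 - 2 * ∑ h, ∑ k, m h * P h k * (g h * g k) := by
          rw [mul_sum]; simp_rw [mul_sum]; rw [← sum_add_distrib, ← sum_sub_distrib]
          exact sum_congr rfl fun h _ => by rw [← sum_add_distrib, ← sum_sub_distrib]
      _ = _ := by rw [e1, e2]
  have hlhs : ∑ h, m h * g h * (g h - σ * ∑ k, P h k * g k) = ∑ h, m h * g h ^ 2 - σ * ∑ h, ∑ k, m h * P h k * (g h * g k) := by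
    rw [mul_sum, ← sum_sub_distrib]
    refine sum_congr rfl fun h _ => ?_
    have : m h * g h * (σ * ∑ k, P h k * g k) = σ * ∑ k, m h * P h k * (g h * g k) := by
      rw [Finset.mul_sum, Finset.mul_sum, Finset.mul_sum]; exact sum_congr rfl fun k _ => by ring
    rw [mul_sub, this]; ring
  rw [hlhs, hsq]; ring

omit [DecidableEq T] in
/-- The Dirichlet form is non-negative (`m ≥ 0`, `P ≥ 0`, `0 ≤ σ ≤ 1`). [ours] -/
theorem dirichlet_form_nonneg (hrev : ∀ h k, m h * P h k = m k * P k h) (hP0 : ∀ h k, 0 ≤ P h k) (hP1 : ∀ h, ∑ k, P h k = 1) (hm0 : ∀ h, 0 ≤ m h)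
    (hσ0 : 0 ≤ σ) (hσ1 : σ ≤ 1) (g : T → ℝ) : 0 ≤ ∑ h, m h * g h * (g h - σ * ∑ k, P h k * g k) := by
  rw [dirichlet_form_eq hrev hP1 g]
  have h1 : 0 ≤ ∑ h, m h * g h ^ 2 := sum_nonneg fun h _ => mul_nonneg (hm0 h) (sq_nonneg _)
  have h2 : 0 ≤ ∑ h, ∑ k, m h * P h k * (g h - g k) ^ 2 := sum_nonneg fun h _ => sum_nonneg fun k _ => mul_nonneg (mul_nonneg (hm0 h) (hP0 h k)) (sq_nonneg _)
  have h3 : 0 ≤ 1 - σ := by linarith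
  positivity

omit [DecidableEq T] in
/-- The bilinear form `⟨g, (I − σP)f⟩_m` is symmetric under reversibility. [ours] -/
theorem dirichlet_bilinear_symm (hrev : ∀ h k, m h * P h k = m k * P k h) (f g : T → ℝ) :
    ∑ h, m h * g h * (f h - σ * ∑ k, P h k * f k) = ∑ h, m h * f h * (g h - σ * ∑ k, P h k * g k) := by
  have e : ∀ (f g : T → ℝ), ∑ h, m h * g h * (f h - σ * ∑ k, P h k * f k) = ∑ h, m h * g h * f h - σ * ∑ h, ∑ k, m h * P h k * (g h * f k) := by
    intro f g
    rw [mul_sum, ← sum_sub_distrib]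
    refine sum_congr rfl fun h _ => ?_
    have : m h * g h * (σ * ∑ k, P h k * f k) = σ * ∑ k, m h * P h k * (g h * f k) := by
      rw [Finset.mul_sum, Finset.mul_sum, Finset.mul_sum]; exact sum_congr rfl fun k _ => by ring
    rw [mul_sub, this]
  rw [e f g, e g f]
  have hs : ∑ h, ∑ k, m h * P h k * (g h * f k) = ∑ h, ∑ k, m h * P h k * (f h * g k) := by
    rw [sum_comm]
    exact sum_congr rfl fun k _ => sum_congr rfl fun h _ => by rw [hrev h k]; ring
  rw [hs]
  congr 1
  exact sum_congr rfl fun h _ => by ring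

/-- **THE VARIATIONAL INEQUALITY:** for the column resolvent `f = δ_z + σPf`, every test function `g` gives `2m(z)g(z) − Q(g) ≤ m(z)f(z)`
(`Q(g) = Σ_h m(h)g(h)(g − σPg)(h)`). [ours] -/
theorem resolventDiag_variational (hrev : ∀ h k, m h * P h k = m k * P k h) (hP0 : ∀ h k, 0 ≤ P h k) (hP1 : ∀ h, ∑ k, P h k = 1) (hm0 : ∀ h, 0 ≤ m h)
    (hσ0 : 0 ≤ σ) (hσ1 : σ ≤ 1) {z : T} {f : T → ℝ} (hf : ∀ h, f h = (if h = z then 1 else 0) + σ * ∑ k, P h k * f k) (g : T → ℝ) :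
    2 * (m z * g z) - ∑ h, m h * g h * (g h - σ * ∑ k, P h k * g k) ≤ m z * f z := by
  -- `(I − σP)f = δ_z`
  have hres : ∀ h, f h - σ * ∑ k, P h k * f k = if h = z then 1 else 0 := fun h => by rw [hf h]; ring
  -- `⟨g,(I−σP)f⟩ = m(z)g(z)` and `⟨f,(I−σP)f⟩ = m(z)f(z)`
  have hpair : ∀ g : T → ℝ, ∑ h, m h * g h * (f h - σ * ∑ k, P h k * f k) = m z * g z := by
    intro g; simp_rw [hres, mul_ite, mul_one, mul_zero]; rw [Finset.sum_ite_eq' univ z]; simp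
  -- `0 ≤ Q(g − f) = Q(g) − 2⟨g,(I−σP)f⟩ + ⟨f,(I−σP)f⟩`
  have h0 := dirichlet_form_nonneg hrev hP0 hP1 hm0 hσ0 hσ1 (fun h => g h - f h)
  have hexp : ∑ h, m h * (g h - f h) * ((g h - f h) - σ * ∑ k, P h k * (g k - f k))
      = ∑ h, m h * g h * (g h - σ * ∑ k, P h k * g k) - ∑ h, m h * g h * (f h - σ * ∑ k, P h k * f k)
        - ∑ h, m h * f h * (g h - σ * ∑ k, P h k * g k) + ∑ h, m h * f h * (f h - σ * ∑ k, P h k * f k) := by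
    have e : ∀ h, (∑ k, P h k * (g k - f k)) = ∑ k, P h k * g k - ∑ k, P h k * f k := fun h => by
      rw [← sum_sub_distrib]; exact sum_congr rfl fun k _ => by ring
    simp_rw [e]
    rw [← sum_sub_distrib, ← sum_sub_distrib, ← sum_add_distrib]
    exact sum_congr rfl fun h _ => by ring
  rw [hexp, dirichlet_bilinear_symm hrev g f, hpair g, hpair f] at h0
  linarith

/-- **RAYLEIGH MONOTONICITY FOR THE RESOLVENT DIAGONAL:** two reversible kernels `P` (w.r.t. `m`) and `P'` (w.r.t. `m'`) with `m ≤ m'`, conductances `m(h)P(h,k) ≤ m'(h)P'(h,k)` for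
`h ≠ k`, and `m(z) = m'(z) > 0`: the column resolvents from `z` satisfy **`f'(z) ≤ f(z)`**. [ours] -/
theorem resolventDiag_mono {P' : T → T → ℝ} {m' : T → ℝ} (hrev : ∀ h k, m h * P h k = m k * P k h) (hrev' : ∀ h k, m' h * P' h k = m' k * P' k h)
    (hP0 : ∀ h k, 0 ≤ P h k) (hP1 : ∀ h, ∑ k, P h k = 1) (hP'1 : ∀ h, ∑ k, P' h k = 1) (hm0 : ∀ h, 0 ≤ m h)
    (hmm : ∀ h, m h ≤ m' h) (hcc : ∀ h k, h ≠ k → m h * P h k ≤ m' h * P' h k) {z : T} (hz : m z = m' z) (hmz : 0 < m z)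
    (hσ0 : 0 ≤ σ) (hσ1 : σ ≤ 1) {f f' : T → ℝ} (hf : ∀ h, f h = (if h = z then 1 else 0) + σ * ∑ k, P h k * f k)
    (hf' : ∀ h, f' h = (if h = z then 1 else 0) + σ * ∑ k, P' h k * f' k) : f' z ≤ f z := by
  -- the variational bound for `P` at the test function `f'`
  have h1 := resolventDiag_variational hrev hP0 hP1 hm0 hσ0 hσ1 hf f'
  -- `Q ≤ Q'` at `f'`
  have hQ : ∑ h, m h * f' h * (f' h - σ * ∑ k, P h k * f' k) ≤ ∑ h, m' h * f' h * (f' h - σ * ∑ k, P' h k * f' k) := by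
    rw [dirichlet_form_eq hrev hP1 f', dirichlet_form_eq hrev' hP'1 f']
    have ha : ∑ h, m h * f' h ^ 2 ≤ ∑ h, m' h * f' h ^ 2 := sum_le_sum fun h _ => mul_le_mul_of_nonneg_right (hmm h) (sq_nonneg _)
    have hb : ∑ h, ∑ k, m h * P h k * (f' h - f' k) ^ 2 ≤ ∑ h, ∑ k, m' h * P' h k * (f' h - f' k) ^ 2 := by
      refine sum_le_sum fun h _ => sum_le_sum fun k _ => ?_
      by_cases hhk : h = k
      · subst hhk; simp
      · exact mul_le_mul_of_nonneg_right (hcc h k hhk) (sq_nonneg _)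
    have h3 : 0 ≤ 1 - σ := by linarith
    nlinarith [mul_le_mul_of_nonneg_left ha h3, mul_le_mul_of_nonneg_left hb (by linarith : 0 ≤ σ / 2)]
  -- `Q'(f') = m'(z)f'(z)`
  have hres' : ∀ h, f' h - σ * ∑ k, P' h k * f' k = if h = z then 1 else 0 := fun h => by rw [hf' h]; ring
  have hQ' : ∑ h, m' h * f' h * (f' h - σ * ∑ k, P' h k * f' k) = m' z * f' z := by
    simp_rw [hres', mul_ite, mul_one, mul_zero]; rw [Finset.sum_ite_eq' univ z]; simp
  rw [hQ', ← hz] at hQ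
  nlinarith

/-- **Row tail resolvent to column resolvent under reversibility:** if `ũ = (1−σ)P(z,·) + σũP` and `m`-null rows do not charge non-null states, then
`f(t) = m(z)((1−σ)𝟙{t=z} + σũ(t))/((1−σ)m(t))` solves the column equation `f = δ_z + σPf` (`σ < 1`, `m(z) > 0`). [ours] -/
theorem rowResolvent_to_column (hrev : ∀ h k, m h * P h k = m k * P k h) (hσ1 : σ < 1) {z : T} (hmz : 0 < m z) (hm0 : ∀ h, 0 ≤ m h)
    (hnull : ∀ t k, m t = 0 → m k ≠ 0 → P t k = 0)
    {ut : T → ℝ} (hut : ∀ t, ut t = (1 - σ) * P z t + σ * ∑ k, ut k * P k t)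
    {f : T → ℝ} (hf : ∀ t, f t = m z * ((1 - σ) * (if t = z then 1 else 0) + σ * ut t) / ((1 - σ) * m t)) :
    ∀ t, f t = (if t = z then 1 else 0) + σ * ∑ k, P t k * f k := by
  have h1σ : 0 < 1 - σ := by linarith
  -- `f` vanishes on null states
  have hf0 : ∀ t, m t = 0 → f t = 0 := fun t ht => by rw [hf t, ht]; simp
  intro t
  by_cases ht : m t = 0
  · -- null row: only null states are charged, where `f = 0`; and `t ≠ z`
    have htz : t ≠ z := fun e => by rw [e] at ht; linarith
    rw [hf0 t ht, if_neg htz]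
    have : ∑ k, P t k * f k = 0 := sum_eq_zero fun k _ => by
      by_cases hk : m k = 0
      · rw [hf0 k hk, mul_zero]
      · rw [hnull t k ht hk, zero_mul]
    rw [this]; ring
  · have hmt : 0 < m t := lt_of_le_of_ne (hm0 t) (Ne.symm ht)
    -- `σ Σ_k P(t,k) f(k) = (m z/((1−σ) m t)) · σ Σ_k ut(k) P(k,t)` by detailed balance
    have hsum : ∑ k, P t k * f k = m z / ((1 - σ) * m t) * ∑ k, ((1 - σ) * (if k = z then 1 else 0) + σ * ut k) * P k t := by
      rw [mul_sum]
      refine sum_congr rfl fun k _ => ?_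
      by_cases hk : m k = 0
      · have hkz : k ≠ z := fun e => by rw [e] at hk; linarith
        have hPkt : P k t = 0 := hnull k t hk ht
        rw [hf0 k hk, hPkt, if_neg hkz]; ring
      · have hmk : 0 < m k := lt_of_le_of_ne (hm0 k) (Ne.symm hk)
        rw [hf k]
        have hdb : P t k = m k * P k t / m t := by rw [← hrev t k]; field_simp
        rw [hdb]; field_simp
    -- `Σ_k ((1−σ)δ_z(k) + σ ut k) P(k,t) = (1−σ)P(z,t) + σ Σ_k ut k P k t = ut t`
    have hrow : ∑ k, ((1 - σ) * (if k = z then 1 else 0) + σ * ut k) * P k t = ut t := by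
      have e : ∑ k, ((1 - σ) * (if k = z then 1 else 0) + σ * ut k) * P k t = (1 - σ) * P z t + σ * ∑ k, ut k * P k t := by
        rw [show (∑ k, ((1 - σ) * (if k = z then 1 else 0) + σ * ut k) * P k t) = ∑ k, ((1 - σ) * ((if k = z then 1 else 0) * P k t) + σ * (ut k * P k t)) from
          sum_congr rfl fun k _ => by ring, sum_add_distrib, ← mul_sum, ← mul_sum]
        congr 1; simp_rw [ite_mul, one_mul, zero_mul]; rw [Finset.sum_ite_eq' univ z]; simp
      rw [e, ← hut t]
    rw [hsum, hrow, hf t]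
    by_cases htz : t = z
    · subst htz; simp only [if_true]; field_simp
    · rw [if_neg htz]; field_simp; ring

end Dirichlet

/-! ## §2 Domination at the start content for the tagged hub chains -/

section TaggedStart
variable {S : Type*} [Fintype S] [DecidableEq S]
variable {W : S → ℝ} {acc : S → S → ℝ} {K : ℕ} {NC : S → ℕ} {s : S} {P : Option S → Option S → ℝ}

omit [Fintype S] in
/-- **Detailed balance of the tagged hub chain** w.r.t. `m(v) = N_C(v)/W_v`, `m(★) = 1/W_s`. [ours] -/
theorem tagged_detailedBalance (hW : ∀ v, 0 < W v) (hacc : ∀ h v, acc h v = min 1 (W h / W v))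
    (hPoff : ∀ h v, h ≠ v → P (some h) (some v) = if NC h = 0 then 0 else (NC v : ℝ) / K * acc h v)
    (hPin : ∀ h, P (some h) none = if NC h = 0 then 0 else acc h s / K)
    (hPout : ∀ v, P none (some v) = (NC v : ℝ) / K * acc s v)
    {m : Option S → ℝ} (hms : ∀ v, m (some v) = (NC v : ℝ) / W v) (hmn : m none = 1 / W s) :
    ∀ t t', m t * P t t' = m t' * P t' t := by
  -- the symmetric kernel `acc(h,v)/W_h = acc(v,h)/W_v = min{1/W_h, 1/W_v}`
  have hsym : ∀ h v, acc h v / W h = acc v h / W v := by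
    intro h v
    rw [hacc, hacc]
    have hWh := hW h; have hWv := hW v
    rcases le_total (W h) (W v) with hle | hle
    · rw [min_eq_right ((div_le_one hWv).mpr hle), min_eq_left ((one_le_div hWh).mpr hle)]; field_simp
    · rw [min_eq_left ((one_le_div hWv).mpr hle), min_eq_right ((div_le_one hWh).mpr hle)]; field_simp
  intro t t'
  rcases t with _ | h <;> rcases t' with _ | v
  · rfl
  · by_cases hv : NC v = 0
    · rw [hmn, hms, hPout, hPin, if_pos hv, hv]; simp
    · rw [hmn, hms, hPout, hPin, if_neg hv]
      calc 1 / W s * ((NC v : ℝ) / K * acc s v) = (NC v : ℝ) / K * (acc s v / W s) := by ring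
        _ = (NC v : ℝ) / K * (acc v s / W v) := by rw [hsym s v]
        _ = (NC v : ℝ) / W v * (acc v s / K) := by ring
  · by_cases hh : NC h = 0
    · rw [hmn, hms, hPout, hPin, if_pos hh, hh]; simp
    · rw [hmn, hms, hPout, hPin, if_neg hh]
      calc (NC h : ℝ) / W h * (acc h s / K) = (NC h : ℝ) / K * (acc h s / W h) := by ring
        _ = (NC h : ℝ) / K * (acc s h / W s) := by rw [hsym h s]
        _ = 1 / W s * ((NC h : ℝ) / K * acc s h) := by ring
  · by_cases hhv : h = v
    · subst hhv; rfl
    · rw [hms, hms, hPoff h v hhv, hPoff v h (Ne.symm hhv)]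
      by_cases hh : NC h = 0
      · rw [if_pos hh, hh]
        by_cases hv : NC v = 0
        · rw [if_pos hv]; simp
        · rw [if_neg hv]; simp
      · by_cases hv : NC v = 0
        · rw [if_neg hh, if_pos hv, hv]; simp
        · rw [if_neg hh, if_neg hv]
          calc (NC h : ℝ) / W h * ((NC v : ℝ) / K * acc h v) = (NC h : ℝ) * (NC v : ℝ) / K * (acc h v / W h) := by ring
            _ = (NC h : ℝ) * (NC v : ℝ) / K * (acc v h / W v) := by rw [hsym h v]
            _ = (NC v : ℝ) / W v * ((NC h : ℝ) / K * acc v h) := by ring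

omit [Fintype S] [DecidableEq S] in
/-- The reversing masses `m(v) = N_C(v)/W_v`, `m(★) = 1/W_s` are non-negative. [ours] -/
theorem tagged_mass_nonneg (hW : ∀ v, 0 < W v) : ∀ t : Option S, 0 ≤ Option.elim t (1 / W s) (fun v => (NC v : ℝ) / W v) := by
  intro t; rcases t with _ | v
  · simp; exact (hW s).le
  · simp; exact div_nonneg (Nat.cast_nonneg _) (hW v).le

omit [Fintype S] [DecidableEq S] in
/-- A null mass is an absent ordinary content. [ours] -/
theorem tagged_mass_eq_zero (hW : ∀ v, 0 < W v) {t : Option S} (ht : Option.elim t (1 / W s) (fun v => (NC v : ℝ) / W v) = 0) : ∃ h, t = some h ∧ NC h = 0 := by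
  rcases t with _ | h
  · exfalso; simp at ht; exact (hW s).ne' (by linarith [hW s, ht])
  · refine ⟨h, rfl, ?_⟩
    simp at ht; rcases ht with ht | ht
    · exact_mod_cast ht
    · exact absurd ht (hW h).ne'

omit [Fintype S] [DecidableEq S] in
/-- Null rows (absent contents) do not charge non-null states. [ours] -/
theorem tagged_null_row (hW : ∀ v, 0 < W v)
    (hPoff : ∀ h v, h ≠ v → P (some h) (some v) = if NC h = 0 then 0 else (NC v : ℝ) / K * acc h v)
    (hPin : ∀ h, P (some h) none = if NC h = 0 then 0 else acc h s / K) :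
    ∀ t k, Option.elim t (1 / W s) (fun v => (NC v : ℝ) / W v) = 0 → Option.elim k (1 / W s) (fun v => (NC v : ℝ) / W v) ≠ 0 → P t k = 0 := by
  intro t k ht hk
  obtain ⟨h, rfl, hh⟩ := tagged_mass_eq_zero (NC := NC) hW ht
  rcases k with _ | v
  · rw [hPin, if_pos hh]
  · have hhv : h ≠ v := fun e => hk (by subst e; simp [hh])
    rw [hPoff h v hhv, if_pos hh]

variable {θ : S → ℝ} {p : ℝ} {a b : S} {PX PY : Option S → Option S → ℝ} {xt yt : Option S → ℝ} {σ : ℝ}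

/-- **DOMINATION AT THE START CONTENT** (the `w = z` instance of hypothesis (D) of `Scaling/AdjacentPairPersistence`): for the tagged hub chains of `N_C + δ_a` (tag `a`) and
`N_C + δ_b` (tag `b`) with `W_b ≤ W_a` and a common ordinary start `z`, the tail laws at any odds `σ ∈ [0,1)` satisfy **`ỹ(z) ≤ x̃(z)`**. [ours] -/
theorem tagged_start_domination (hW : ∀ v, 0 < W v) (hacc : ∀ h v, acc h v = min 1 (W h / W v)) (hK : 1 ≤ K) (hNC : ∑ v, NC v = K) (hab : W b ≤ W a)
    (hPXoff : ∀ h v, h ≠ v → PX (some h) (some v) = if NC h = 0 then 0 else (NC v : ℝ) / K * acc h v)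
    (hPXin : ∀ h, PX (some h) none = if NC h = 0 then 0 else acc h a / K)
    (hPXdiag : ∀ h, PX (some h) (some h) = 1 - (∑ v ∈ univ.erase h, PX (some h) (some v) + PX (some h) none))
    (hPXout : ∀ v, PX none (some v) = (NC v : ℝ) / K * acc a v) (hPXstay : PX none none = 1 - ∑ v, PX none (some v))
    (hPYoff : ∀ h v, h ≠ v → PY (some h) (some v) = if NC h = 0 then 0 else (NC v : ℝ) / K * acc h v)
    (hPYin : ∀ h, PY (some h) none = if NC h = 0 then 0 else acc h b / K)
    (hPYdiag : ∀ h, PY (some h) (some h) = 1 - (∑ v ∈ univ.erase h, PY (some h) (some v) + PY (some h) none))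
    (hPYout : ∀ v, PY none (some v) = (NC v : ℝ) / K * acc b v) (hPYstay : PY none none = 1 - ∑ v, PY none (some v))
    (hσ0 : 0 ≤ σ) (hσ1 : σ < 1) {z : S} (hz : NC z ≠ 0)
    (hxt : ∀ t, xt t = (1 - σ) * PX (some z) t + σ * ∑ t', xt t' * PX t' t) (hyt : ∀ t, yt t = (1 - σ) * PY (some z) t + σ * ∑ t', yt t' * PY t' t) :
    yt (some z) ≤ xt (some z) := by
  classical
  -- the case `σ = 0`: one step, and `X` holds more at `z`
  rcases eq_or_lt_of_le hσ0 with hσ | hσpos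
  · subst hσ
    have ex : xt (some z) = PX (some z) (some z) := by rw [hxt]; simp
    have ey : yt (some z) = PY (some z) (some z) := by rw [hyt]; simp
    rw [ex, ey, hPXdiag, hPYdiag, hPXin, hPYin, if_neg hz, if_neg hz]
    have hoff : ∑ v ∈ univ.erase z, PX (some z) (some v) = ∑ v ∈ univ.erase z, PY (some z) (some v) :=
      sum_congr rfl fun v hv => by rw [hPXoff z v (ne_of_mem_erase hv).symm, hPYoff z v (ne_of_mem_erase hv).symm]
    have hacc_le : acc z a ≤ acc z b := by
      rw [hacc, hacc]; exact min_le_min le_rfl (div_le_div_of_nonneg_left (hW z).le (hW b) hab)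
    have hK0 : (0 : ℝ) < K := by exact_mod_cast hK
    have := div_le_div_of_nonneg_right hacc_le hK0.le
    linarith
  · -- reversing measures
    set mX : Option S → ℝ := fun t => Option.elim t (1 / W a) (fun v => (NC v : ℝ) / W v) with hmX
    set mY : Option S → ℝ := fun t => Option.elim t (1 / W b) (fun v => (NC v : ℝ) / W v) with hmY
    have hrevX := tagged_detailedBalance hW hacc hPXoff hPXin hPXout (m := mX) (fun v => by simp [hmX]) (by simp [hmX])
    have hrevY := tagged_detailedBalance hW hacc hPYoff hPYin hPYout (m := mY) (fun v => by simp [hmY]) (by simp [hmY])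
    have hP0X := tagged_nonneg hW hacc hPXoff hPXin hPXdiag hPXout hPXstay hK hNC
    have hP1X := tagged_rowsum (P := PX) hPXdiag hPXstay
    have hP1Y := tagged_rowsum (P := PY) hPYdiag hPYstay
    have hm0 : ∀ t, 0 ≤ mX t := tagged_mass_nonneg (NC := NC) (s := a) hW
    have hmm : ∀ t, mX t ≤ mY t := by
      intro t; rcases t with _ | v
      · have := one_div_le_one_div_of_le (hW b) hab; simpa [hmX, hmY, one_div] using this
      · simp [hmX, hmY]
    -- acceptance comparisons
    have hsym : ∀ h v, acc h v / W h = acc v h / W v := by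
      intro h v
      rw [hacc, hacc]
      have hWh := hW h; have hWv := hW v
      rcases le_total (W h) (W v) with hle | hle
      · rw [min_eq_right ((div_le_one hWv).mpr hle), min_eq_left ((one_le_div hWh).mpr hle)]; field_simp
      · rw [min_eq_left ((one_le_div hWv).mpr hle), min_eq_right ((div_le_one hWh).mpr hle)]; field_simp
    have hacc_ab : ∀ h, acc h a ≤ acc h b := fun h => by
      rw [hacc, hacc]; exact min_le_min le_rfl (div_le_div_of_nonneg_left (hW h).le (hW b) hab)
    have hK0 : (0 : ℝ) < K := by exact_mod_cast hK
    have hcc : ∀ t t', t ≠ t' → mX t * PX t t' ≤ mY t * PY t t' := by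
      intro t t' htt
      rcases t with _ | h <;> rcases t' with _ | v
      · exact absurd rfl htt
      · -- `(1/W_a)(N_v/K)acc(a,v) ≤ (1/W_b)(N_v/K)acc(b,v)`: `acc(a,v)/W_a = acc(v,a)/W_v ≤ acc(v,b)/W_v = acc(b,v)/W_b`
        simp only [hmX, hmY, Option.elim]
        rw [hPXout, hPYout]
        have e1 : 1 / W a * ((NC v : ℝ) / K * acc a v) = (NC v : ℝ) / K * (acc a v / W a) := by ring
        have e2 : 1 / W b * ((NC v : ℝ) / K * acc b v) = (NC v : ℝ) / K * (acc b v / W b) := by ring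
        rw [e1, e2, hsym a v, hsym b v]
        exact mul_le_mul_of_nonneg_left (div_le_div_of_nonneg_right (hacc_ab v) (hW v).le) (div_nonneg (Nat.cast_nonneg _) hK0.le)
      · simp only [hmX, hmY, Option.elim]
        rw [hPXin, hPYin]
        by_cases hh : NC h = 0
        · rw [if_pos hh, if_pos hh]
        · rw [if_neg hh, if_neg hh]
          exact mul_le_mul_of_nonneg_left (div_le_div_of_nonneg_right (hacc_ab h) hK0.le) (div_nonneg (Nat.cast_nonneg _) (hW h).le)
      · have hhv : h ≠ v := fun e => htt (by rw [e])
        simp only [hmX, hmY, Option.elim]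
        rw [hPXoff h v hhv, hPYoff h v hhv]
    have hzm : mX (some z) = mY (some z) := by simp [hmX, hmY]
    have hmz : 0 < mX (some z) := by
      simp [hmX]; exact div_pos (by exact_mod_cast Nat.pos_of_ne_zero hz) (hW z)
    -- null rows (absent contents) are identity rows
    have hnullX : ∀ t k, mX t = 0 → mX k ≠ 0 → PX t k = 0 := tagged_null_row (s := a) hW hPXoff hPXin
    have hnullY : ∀ t k, mY t = 0 → mY k ≠ 0 → PY t k = 0 := tagged_null_row (s := b) hW hPYoff hPYin
    -- column resolvents
    set fX : Option S → ℝ := fun t => mX (some z) * ((1 - σ) * (if t = some z then 1 else 0) + σ * xt t) / ((1 - σ) * mX t) with hfX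
    set fY : Option S → ℝ := fun t => mY (some z) * ((1 - σ) * (if t = some z then 1 else 0) + σ * yt t) / ((1 - σ) * mY t) with hfY
    have hfXeq := rowResolvent_to_column hrevX hσ1 hmz hm0 hnullX hxt (f := fX) (fun t => rfl)
    have hfYeq := rowResolvent_to_column hrevY hσ1 (hzm ▸ hmz) (fun t => (hm0 t).trans (hmm t)) hnullY hyt (f := fY) (fun t => rfl)
    have hmono := resolventDiag_mono hrevX hrevY hP0X hP1X hP1Y hm0 hmm hcc hzm hmz hσ0 hσ1.le hfXeq hfYeq
    -- translate back
    have h1σ : 0 < 1 - σ := by linarith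
    have eX : fX (some z) = ((1 - σ) + σ * xt (some z)) / (1 - σ) := by
      simp only [hfX, if_true]; field_simp
    have eY : fY (some z) = ((1 - σ) + σ * yt (some z)) / (1 - σ) := by
      have hmz' : 0 < mY (some z) := hzm ▸ hmz
      simp only [hfY, if_true]; field_simp
    rw [eX, eY, div_le_div_iff_of_pos_right h1σ] at hmono
    nlinarith

end TaggedStart

end Summit.Ventures.LatticeQCDFlow.Scaling
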